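import Summits.QuantumFields.BalabanUV.Beta.CompositeCorrectorForms

/-!
# `BalabanUV.Beta.CompositeCorrectorCovariance` — binder row D1, work item K-U3d leaf L1b: **THE (a1*)_m CORRECTORS DO NOT TOUCH INTRA-BLOCK (COMB)
# COORDINATES, AND ARE COVARIANT UNDER COARSE TRANSLATIONS** (the two Form-level inputs of the kernelisation L2 and of the `axEc`-slice rule of L3)
# (β sub-cell, BINDER-OWNERS row D1 OWNER, lineage an2 gen 24; memo `gen24/K-U3d-LEAVES.v1.md` «L1 addenda»; sequel of L1 `CompositeCorrectorForms`)

HONEST FRAMING (cell charter, verbatim): «discharging BetaPertH makes Balaban's UV stability UNCONDITIONAL — a real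
constructive-QFT result; it is NOT the continuum limit and NOT the Clay problem.»
HONEST DEPENDENCY: continuum YM on T⁴ ⇐ BetaPertH ∧ nine spine estimates (0/9 proved); BetaPertH ⇐ (D1) ∧ (D4) ∧ CAP+tail;
G-an2-4 gates asym, D1 and NE2/3/4.
ABSOLUTE RULE (cell, verbatim): «No internally-minted statement may enter as a cited fact. Every hypothesis is either kernel-proved in this
package or a verbatim quotation of a PUBLISHED theorem with page reference. The manuscript(s) under audit are NOT citable for their own
disputed steps — they are the thing under adjudication; programme-internal (2001/route/tribunal) claims are never citable.»
NOTHING below is cited: no `[cite: …]`, no `def`, no `Prop` fact.  [folklore] finite-difference algebra over L1 `CompositeCorrectorForms` (`ext`, `corrPhi`, `corrPsi`,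
`compDefectAt` …), an1's `AveragingContours.shift ∕ axial_add`, `AveragingContoursRooted.linAvgAt_add`, `AxialProjector.blk_add_zsmul` BY NAME.

WHY (row-D1 owner, gen 24).  (i) `axEc`'s field block is the diagonal indicator of the NON-comb bonds (`AxialCoordinateProjectorCoarse.axEc_inl_inl`); a comb bond
is intra-block (second conjunct of `AxialDressingRooted.IsCombBondAt`), and the correction term `dz (ext n h)` vanishes on every intra-block bond — so the
correctors act as the identity on comb coordinates: the coordinate form of «`E·Ψ·E = Ψ·E`» that L3 turns into `comp (comp axEc psiK) axEc = comp psiK axEc`.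
(ii) Block-translation covariance by `n•v` is what makes the kernelised correctors (L2) `n`-periodic, hence bounded with finite range, hence `Spr`.

WHAT (all [folklore]): §1 `dz_ext_eq_zero_of_blk_eq`, **`corrPhi_apply_of_blk_eq`**, **`corrPsi_apply_of_blk_eq`**; §2 `treeGaugeAt_shift`, `blockSum_shift`, `linAvgAt_shift`,
`compLinAvgAt_shift`, `compDefectAt_shift`, `ext_shift`, **`corrPhi_shift`**, **`corrPsi_shift`**.
Provenance: β sub-cell, unit beta-an2 gen 24 (prover-b2b-balaban-beta-an2-g24-0), 2026-08-20.  NOT (SDF), NOT D1, NOT `BetaPertH`, NOT continuum, NOT Clay.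
-/

namespace Summit.QuantumFields.BalabanUV.Beta.CompositeCorrectorCovariance

open Finset
open scoped BigOperators
open Literature.MathematicalPhysics.QuantumFieldTheory.Balaban1983to89.Beta
open AffineAveraging (Site Form0 Form1 box toSite unitVec dz blockSum)
open AveragingContours (blk blk_block shift axial_add)
open AveragingContoursRooted (linAvgAt treeGaugeAt)
open AxialProjector (blk_add_zsmul)
open Summit.QuantumFields.BalabanUV.Beta.CompositeAveragingCoarseExact (compLinAvgAt compDefectAt compLinAvgAt_succ compDefectAt_succ)
open Summit.QuantumFields.BalabanUV.Beta.CompositeCorrectorForms (ext ext_apply corrPhi corrPsi)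

noncomputable section

variable {d : ℕ}

/-! ## §1 The correctors do not touch intra-block (comb) coordinates -/

/-- [folklore] The exact form of a block-constant function vanishes on every INTRA-BLOCK bond (`blk N (x + e_α) = blk N x` — in particular on every comb bond,
the second conjunct of `AxialDressingRooted.IsCombBondAt`). -/
theorem dz_ext_eq_zero_of_blk_eq {N : ℕ} (h : Form0 d ℝ) {α : Fin d} {x : Site d} (hx : blk N (x + unitVec α) = blk N x) :
    dz (ext N h) α x = 0 := by
  rw [dz, ext_apply, ext_apply, hx, sub_self]

/-- [folklore] **`Φ_m` DOES NOT TOUCH INTRA-BLOCK COORDINATES**: `blk n (x + e_α) = blk n x ⟹ (Φ_m A) α x = A α x` (`n = L^m`).  With `axEc`'s field block = the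
diagonal indicator of the NON-comb bonds, this is the coordinate form of slice preservation used by L3. -/
theorem corrPhi_apply_of_blk_eq (r : ℕ → (Fin d → ℕ)) (L m : ℕ) (A : Form1 d ℝ) {α : Fin d} {x : Site d}
    (hx : blk (L ^ m) (x + unitVec α) = blk (L ^ m) x) : corrPhi r L m A α x = A α x := by
  rw [corrPhi, Pi.sub_apply, Pi.sub_apply, Pi.smul_apply, Pi.smul_apply, dz_ext_eq_zero_of_blk_eq _ hx, smul_zero, sub_zero]

/-- [folklore] **`Ψ_m` DOES NOT TOUCH INTRA-BLOCK COORDINATES.** -/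
theorem corrPsi_apply_of_blk_eq (r : ℕ → (Fin d → ℕ)) (L m : ℕ) (A : Form1 d ℝ) {α : Fin d} {x : Site d}
    (hx : blk (L ^ m) (x + unitVec α) = blk (L ^ m) x) : corrPsi r L m A α x = A α x := by
  rw [corrPsi, Pi.add_apply, Pi.add_apply, Pi.smul_apply, Pi.smul_apply, dz_ext_eq_zero_of_blk_eq _ hx, smul_zero, add_zero]

/-! ## §2 Coarse translation covariance -/

/-- [folklore] Coarse translation covariance of the rooted tree gauge: `treeGaugeAt ρ (shift (L•v) A) L x = treeGaugeAt ρ A L (x + L•v)` (`1 ≤ L`). -/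
theorem treeGaugeAt_shift {L : ℕ} (hL : 1 ≤ L) (ρ : Site d) (A : Form1 d ℝ) (v x : Site d) :
    treeGaugeAt ρ (shift ((L : ℤ) • v) A) L x = treeGaugeAt ρ A L (x + (L : ℤ) • v) := by
  rw [treeGaugeAt, treeGaugeAt, blk_add_zsmul hL, ← axial_add]
  congr 1
  rw [smul_add]; abel

/-- [folklore] Coarse translation covariance of the block sum: `blockSum L (f ∘ (· + L•v)) = (blockSum L f) ∘ (· + v)`. -/
theorem blockSum_shift (L : ℕ) (f : Form0 d ℝ) (v : Site d) :
    blockSum L (fun x => f (x + (L : ℤ) • v)) = fun y => blockSum L f (y + v) := by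
  funext y
  simp only [blockSum, smul_add]
  refine Finset.sum_congr rfl fun b _ => ?_
  congr 1; abel

/-- [folklore] Coarse translation covariance of the rooted linear averaging, as a 1-form identity: `linAvgAt ρ (shift (L•v) A) L = shift v (linAvgAt ρ A L)`. -/
theorem linAvgAt_shift (ρ : Site d) (A : Form1 d ℝ) (L : ℕ) (v : Site d) :
    (linAvgAt ρ (shift ((L : ℤ) • v) A) L : Form1 d ℝ) = shift v (linAvgAt ρ A L : Form1 d ℝ) := by
  funext μ y
  rw [shift, ← AveragingContoursRooted.linAvgAt_add]

/-- [folklore] **COVARIANCE OF THE COMPOSITE**: `compLinAvgAt r L k (shift (L^j • v) A) = shift (L^(j−k) • v) (compLinAvgAt r L k A)` for `k ≤ j`, stated as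
`compLinAvgAt r L k (shift ((L^(i+k) : ℤ) • v) A) = shift ((L^i : ℤ) • v) (compLinAvgAt r L k A)`. -/
theorem compLinAvgAt_shift (r : ℕ → (Fin d → ℕ)) (L : ℕ) (A : Form1 d ℝ) (v : Site d) :
    ∀ k i : ℕ, compLinAvgAt r L k (shift (((L ^ (i + k) : ℕ) : ℤ) • v) A) = shift (((L ^ i : ℕ) : ℤ) • v) (compLinAvgAt r L k A)
  | 0, i => by simp [compLinAvgAt]
  | k + 1, i => by
      rw [compLinAvgAt_succ, compLinAvgAt_succ, show i + (k + 1) = (i + 1) + k by ring, compLinAvgAt_shift r L A v k (i + 1),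
        ← linAvgAt_shift]
      congr 2
      push_cast
      rw [pow_succ, mul_comm, mul_smul]

/-- [folklore] **COVARIANCE OF THE DEFECT POTENTIAL**: `compDefectAt r L k (shift (L^(i+k) • v) A) = (compDefectAt r L k A) ∘ (· + L^i • v)` (`1 ≤ L`). -/
theorem compDefectAt_shift {L : ℕ} (hL : 1 ≤ L) (r : ℕ → (Fin d → ℕ)) (A : Form1 d ℝ) (v : Site d) :
    ∀ k i : ℕ, compDefectAt r L k (shift (((L ^ (i + k) : ℕ) : ℤ) • v) A) = fun Y => compDefectAt r L k A (Y + (((L ^ i : ℕ) : ℤ) • v))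
  | 0, i => by funext Y; simp [compDefectAt]
  | k + 1, i => by
      rw [compDefectAt_succ, compDefectAt_succ, show i + (k + 1) = (i + 1) + k by ring, compDefectAt_shift hL r A v k (i + 1),
        compLinAvgAt_shift r L A v k (i + 1)]
      have e : (((L ^ (i + 1) : ℕ) : ℤ) • v) = (L : ℤ) • ((((L ^ i : ℕ) : ℤ)) • v) := by
        push_cast; rw [pow_succ, mul_comm, mul_smul]
      rw [e]
      have ht : treeGaugeAt (toSite (r k)) (shift ((L : ℤ) • ((((L ^ i : ℕ) : ℤ)) • v)) (compLinAvgAt r L k A)) L =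
          fun x => treeGaugeAt (toSite (r k)) (compLinAvgAt r L k A) L (x + (L : ℤ) • ((((L ^ i : ℕ) : ℤ)) • v)) :=
        funext fun x => treeGaugeAt_shift hL _ _ _ x
      rw [ht, ← blockSum_shift]
      rfl

/-- [folklore] `blk` and `ext` under coarse translations: `ext N h (x + N•v) = ext N (h ∘ (· + v)) x` (`1 ≤ N`). -/
theorem ext_shift {N : ℕ} (hN : 1 ≤ N) (h : Form0 d ℝ) (v x : Site d) :
    ext N h (x + (N : ℤ) • v) = ext N (fun Y => h (Y + v)) x := by
  rw [ext_apply, ext_apply, blk_add_zsmul hN]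

/-- [folklore] **COARSE TRANSLATION COVARIANCE OF THE CORRECTORS**: `Φ_m (shift (n•v) A) = shift (n•v) (Φ_m A)`, `n = L^m`, `1 ≤ L`. -/
theorem corrPhi_shift {L : ℕ} (hL : 1 ≤ L) (r : ℕ → (Fin d → ℕ)) (m : ℕ) (A : Form1 d ℝ) (v : Site d) :
    corrPhi r L m (shift (((L ^ m : ℕ) : ℤ) • v) A) = shift (((L ^ m : ℕ) : ℤ) • v) (corrPhi r L m A) := by
  have hz := compDefectAt_shift hL r A v m 0
  rw [zero_add, pow_zero] at hz
  funext α x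
  simp only [corrPhi, Pi.sub_apply, Pi.smul_apply, shift, dz]
  rw [hz]
  have hn : 1 ≤ L ^ m := Nat.one_le_pow _ _ hL
  have e1 : ext (L ^ m) (fun Y => compDefectAt r L m A (Y + (((1 : ℕ) : ℤ) • v))) (x + unitVec α)
      = ext (L ^ m) (compDefectAt r L m A) (x + (((L ^ m : ℕ) : ℤ) • v) + unitVec α) := by
    rw [Nat.cast_one, one_smul, add_right_comm, ext_shift hn]
  have e2 : ext (L ^ m) (fun Y => compDefectAt r L m A (Y + (((1 : ℕ) : ℤ) • v))) x
      = ext (L ^ m) (compDefectAt r L m A) (x + (((L ^ m : ℕ) : ℤ) • v)) := by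
    rw [Nat.cast_one, one_smul, ext_shift hn]
  rw [e1, e2]

/-- [folklore] The same for `Ψ_m`. -/
theorem corrPsi_shift {L : ℕ} (hL : 1 ≤ L) (r : ℕ → (Fin d → ℕ)) (m : ℕ) (A : Form1 d ℝ) (v : Site d) :
    corrPsi r L m (shift (((L ^ m : ℕ) : ℤ) • v) A) = shift (((L ^ m : ℕ) : ℤ) • v) (corrPsi r L m A) := by
  have hz := compDefectAt_shift hL r A v m 0
  rw [zero_add, pow_zero] at hz
  funext α x
  simp only [corrPsi, Pi.add_apply, Pi.smul_apply, shift, dz]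
  rw [hz]
  have hn : 1 ≤ L ^ m := Nat.one_le_pow _ _ hL
  have e1 : ext (L ^ m) (fun Y => compDefectAt r L m A (Y + (((1 : ℕ) : ℤ) • v))) (x + unitVec α)
      = ext (L ^ m) (compDefectAt r L m A) (x + (((L ^ m : ℕ) : ℤ) • v) + unitVec α) := by
    rw [Nat.cast_one, one_smul, add_right_comm, ext_shift hn]
  have e2 : ext (L ^ m) (fun Y => compDefectAt r L m A (Y + (((1 : ℕ) : ℤ) • v))) x
      = ext (L ^ m) (compDefectAt r L m A) (x + (((L ^ m : ℕ) : ℤ) • v)) := by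
    rw [Nat.cast_one, one_smul, ext_shift hn]
  rw [e1, e2]


end

end Summit.QuantumFields.BalabanUV.Beta.CompositeCorrectorCovariance
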